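import Summits.CriticalPhenomena.CardyFormulaZ2.Theorems.CardySelfRefinementLagHandOffKernelContactIdentity
import Literature.Probability.LatticeModels.MedialInterfaceProofs
import Literature.Probability.Percolation.PlanarDuality
import HarnessLib

/-!
# The flat-boundary link between the Dobrushin bond model and the half-plane model: stub
`stub_kernel_flatMisdockLink` of line `hitting-tournament` for crux `LagHandOff`
(stmt-CriticalPhenomena-10268)

The LINK brick of the flat boundary kernel of seat c6.  Let `E` be ADMISSIBLE discrete Dobrushin
data at mesh `E.δ` (`DiscreteDobrushin.IsZdAdmissible`), `ω ⊆ E(ℤ²)` a bond configuration,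
`ω° := ω ∩ E(Ω_δ)` its trace on the edges of `Ω_δ = discreteDomainGraph E.Ω E.δ`, and `K(c)` the
set of sites joined to the non-arc site `c ∈ Ω_δ` by `ω°`-open paths inside `Ω_δ ∖ (arcs)` (the
vocabulary of the landed contact identity `stub_kernel_contactIdentity`).  Suppose

* FLATNESS: in the lattice box `[j - M, j + N + M] × [b - 1, b + M]` every site lies in `Ω_δ`,
  the sites of row `b - 1` are exactly the sites of the discrete arc of `A` there, no site lies on
  the discrete arc of `B`, and `ℤ²`-neighbours inside the box are `Ω_δ`-neighbours;
* `4R + H + 2δ ≤ Mδ`;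
* MISDOCK: no `ω`-open contact edge of `Ω_δ` into the arc of `A` is reachable from `c`;
* FAR: some `y₁ ∈ K(c)` is at distance `≥ 3R` from every low strip site (columns `[j, j + N]`,
  rows in `[b, b + H/δ]`).

Then for every LOWEST low strip site `z ∈ K(c)` and every radius `R' ∈ [δ, R]` whose half-disc
`W = {v | b ≤ v 1 ∧ dist (δv, δz) ≤ 4R'}` stays inside the strip columns, (i) `z` is lowest in
its raw-`ω` cluster inside `W`, (ii) the row-`b` sites of that cluster have closed legs into row
`b - 1`, (iii) that cluster reaches distance `3R'` from `z`.

Proof.  (a) Every site of `W` lies in the flat box with column in `[j, j + N]` and row in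
`[b, b + M - 2]` (coordinates are bounded by the distance of mesh points,
`KernelFlatLink.abs_re_sub_le_dist` / `abs_im_sub_le_dist`), so it is a non-arc site of `Ω_δ`,
and an `ω`-open `ℤ²`-edge between two sites of `W` is an `ω°`-edge; hence a raw-`ω` connection
inside `W` from `z` is an `ω°`-connection inside `Ω_δ ∖ arcs` from `c` (walk bookkeeping with
`exists_walk_of_mem_openConnIn` / `mem_openConnIn_of_walk` / `PlanarDuality.openConnIn_trans` of
`Literature/Probability/Percolation/PlanarDuality.lean`).  (i) is then the LOWEST hypothesis;
(ii) an open leg `{w - e₁, w}` at a row-`b` site `w` of the cluster would be an open contact edge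
of `Ω_δ` into the arc of `A` (row `b - 1` of the box) reachable from `c`, contradicting MISDOCK.
(iii) Walk along an `ω°`-open lattice walk inside `Ω_δ ∖ arcs` from `z` to the far site `y₁` and
stop at the FIRST vertex `w` at distance `≥ 3R'` from `z` (`KernelFlatLink.exists_walk_firstHit`);
all earlier vertices are at distance `< 3R'`, a lattice step moves the mesh point by exactly `δ`
(`dist_meshPoint_of_adj` of `Literature/Probability/Percolation/BoxCrossingProofs.lean`), so the
whole prefix is within `3R' + δ ≤ 4R'` of `z`; its rows stay `≥ b` by discrete continuity
(`KernelFlatLink.walk_rows_ge`: rows change by at most one per step and a vertex of row `b - 1`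
in the box would be an arc site, which the walk avoids).  So the prefix is a raw-`ω`-open walk
inside `W`.

Only definitions and lemmas of `DomainDiscretisation.lean`, `MedialInterface.lean`,
`Percolation.lean`, `BoxCrossingProofs.lean`, `PlanarDuality.lean` (walk ↔ `openConnIn`
bookkeeping, `zdGraph_two_adj_iff`, `adj_sub_single_one`) and Mathlib's `SimpleGraph.Walk` API
are used.  Helpers live in the sub-namespace `KernelFlatLink`.
-/

noncomputable section

open Set Metric
open Literature.Probability.Percolation Literature.Probability.LatticeModels

namespace Summit.CriticalPhenomena.CardyFormulaZ2.Cruxes.LagHandOff.HittingTournament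

namespace KernelFlatLink

/-! ### A walk stopped at the first vertex satisfying a predicate -/

/-- The prefix of a walk up to the FIRST vertex satisfying `P` (the endpoint satisfies `P`): a
walk `q` from the start to a vertex `w` with `P w`, whose vertices and edges are vertices and
edges of the original walk, and such that no dart of `q` starts at a vertex satisfying `P`
(all vertices of `q` but the last violate `P`).  Induction along the walk. -/
theorem exists_walk_firstHit {V : Type*} {G : SimpleGraph V} (P : V → Prop) :
    ∀ {u v : V} (p : G.Walk u v), P v →
      ∃ (w : V) (q : G.Walk u w), P w ∧ (∀ x ∈ q.support, x ∈ p.support) ∧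
        (∀ e ∈ q.edges, e ∈ p.edges) ∧ ∀ d ∈ q.darts, ¬ P d.fst := by
  intro u v p
  induction p with
  | nil =>
    intro hu
    exact ⟨_, SimpleGraph.Walk.nil, hu, fun x hx => hx, fun e he => he, fun d hd => by simp at hd⟩
  | @cons a b c h p ih =>
    intro hc
    by_cases ha : P a
    · refine ⟨a, SimpleGraph.Walk.nil, ha, ?_, ?_, ?_⟩
      · intro x hx
        rw [SimpleGraph.Walk.support_nil, List.mem_singleton] at hx
        subst hx
        exact SimpleGraph.Walk.start_mem_support _
      · intro e he
        simp at he
      · intro d hd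
        simp at hd
    · obtain ⟨w, q, hw, hsupp, hedges, hdarts⟩ := ih hc
      refine ⟨w, SimpleGraph.Walk.cons h q, hw, ?_, ?_, ?_⟩
      · intro x hx
        rw [SimpleGraph.Walk.support_cons, List.mem_cons] at hx ⊢
        rcases hx with rfl | hx
        · exact Or.inl rfl
        · exact Or.inr (hsupp x hx)
      · intro e he
        rw [SimpleGraph.Walk.edges_cons, List.mem_cons] at he ⊢
        rcases he with rfl | he
        · exact Or.inl rfl
        · exact Or.inr (hedges e he)
      · intro d hd
        rw [SimpleGraph.Walk.darts_cons, List.mem_cons] at hd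
        rcases hd with rfl | hd
        · exact ha
        · exact hdarts d hd

/-! ### Coordinates and distances of mesh points -/

/-- The horizontal coordinate difference of two sites, scaled by the mesh, is bounded by the
distance of their mesh points (`|re| ≤ ‖·‖`). -/
theorem abs_re_sub_le_dist (δ : ℝ) (v z : Site 2) :
    |δ * v 0 - δ * z 0| ≤ dist (meshPoint δ v) (meshPoint δ z) := by
  rw [Complex.dist_eq, ← meshPoint_re, ← meshPoint_re, ← Complex.sub_re]
  exact Complex.abs_re_le_norm _

/-- The vertical coordinate difference of two sites, scaled by the mesh, is bounded by the
distance of their mesh points (`|im| ≤ ‖·‖`). -/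
theorem abs_im_sub_le_dist (δ : ℝ) (v z : Site 2) :
    |δ * v 1 - δ * z 1| ≤ dist (meshPoint δ v) (meshPoint δ z) := by
  rw [Complex.dist_eq, ← meshPoint_im, ← meshPoint_im, ← Complex.sub_im]
  exact Complex.abs_im_le_norm _

/-! ### Rows stay at least `b` along a walk avoiding the arc row -/

/-- Discrete continuity of the row coordinate along a lattice walk: if every vertex of the walk
satisfies `B` and avoids `A`, every `B`-site of row `b - 1` lies in `A`, and the walk starts at
row `≥ b`, then every vertex of the walk has row `≥ b` (rows change by at most one per step,
`zdGraph_two_adj_iff`, and the first vertex of row `b - 1` would lie in `A`). -/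
theorem walk_rows_ge {A : Set (Site 2)} {B : Site 2 → Prop} {b : ℤ}
    (hA : ∀ v : Site 2, B v → v 1 = b - 1 → v ∈ A) :
    ∀ {x y : Site 2} (q : (zdGraph 2).Walk x y),
      (∀ v ∈ q.support, B v ∧ v ∉ A) → b ≤ x 1 → ∀ v ∈ q.support, b ≤ v 1 := by
  intro x y q
  induction q with
  | nil =>
    intro _ hx v hv
    rw [SimpleGraph.Walk.support_nil, List.mem_singleton] at hv
    subst hv
    exact hx
  | @cons a a' c h p ih =>
    intro hsupp ha v hv
    rw [SimpleGraph.Walk.support_cons, List.mem_cons] at hv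
    rcases hv with rfl | hv
    · exact ha
    · have ha'supp : a' ∈ (SimpleGraph.Walk.cons h p).support := by
        rw [SimpleGraph.Walk.support_cons]
        exact List.mem_cons_of_mem _ p.start_mem_support
      have hstep : a 1 - 1 ≤ a' 1 := by
        rcases (zdGraph_two_adj_iff a a').1 h with ⟨-, h1⟩ | ⟨-, h1⟩ | ⟨h1, -⟩ | ⟨h1, -⟩ <;> omega
      have ha' : b ≤ a' 1 := by
        by_contra hlt
        have heq : a' 1 = b - 1 := by omega
        obtain ⟨hB, hnA⟩ := hsupp a' ha'supp
        exact hnA (hA a' hB heq)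
      exact ih (fun u hu => hsupp u (by
        rw [SimpleGraph.Walk.support_cons]
        exact List.mem_cons_of_mem _ hu)) ha' v hv

end KernelFlatLink

open KernelFlatLink in
/-- **LINK `stub_kernel_flatMisdockLink`.** Under a flat piece of the wired arc (the lattice box
`[j - M, j + N + M] × [b - 1, b + M]` lies in `Ω_δ`, its row `b - 1` is exactly the arc of `A`
there, no arc-`B` sites, `ℤ²`-neighbours in the box are `Ω_δ`-neighbours, `4R + H + 2δ ≤ Mδ`), a
MISDOCKED `ω°`-cluster `K(c)` (no open contact edge into the arc of `A` reachable from `c`)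
containing a site FAR (`≥ 3R`) from the low strip satisfies, at each of its LOWEST low strip
sites `z` and each radius `R' ∈ [δ, R]` whose half-disc `W` of radius `4R'` about `z` stays in
the strip columns: (i) `z` is lowest in its raw-`ω` cluster inside `W`; (ii) the row-`b` sites
`w` of that cluster have closed legs `{w - e₁, w}`; (iii) that cluster reaches distance `3R'`
from `z`.  (a) sites of `W` are non-arc box sites of `Ω_δ` and `ω`-open lattice edges inside `W`
are `ω°`-edges, so the raw cluster inside `W` is part of `K(c)`; (i) LOWEST; (ii) an open leg
would be an open contact into the arc of `A`, contradicting MISDOCK; (iii) the `ω°`-walk from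
`z` to the far site, stopped at the first vertex at distance `≥ 3R'`, stays inside `W` (distance
`< 3R' + δ ≤ 4R'`, rows `≥ b` by discrete continuity). -/
theorem stub_kernel_flatMisdockLink :
    ∀ (E : DiscreteDobrushin), E.IsZdAdmissible → ∀ (ω : BondConfig (Site 2)) (b j : ℤ) (N M : ℕ) (c : Site 2) (H R : ℝ),
      ω ⊆ (zdGraph 2).edgeSet → 0 ≤ H → 0 < R →
      (∀ v : Site 2, j - M ≤ v 0 → v 0 ≤ j + N + M → b - 1 ≤ v 1 → v 1 ≤ b + M →
        v ∈ meshDomain E.Ω E.δ ∧ (v ∈ E.zdArcA ↔ v 1 = b - 1) ∧ v ∉ E.zdArcB) →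
      (∀ v w : Site 2, j - M ≤ v 0 → v 0 ≤ j + N + M → b - 1 ≤ v 1 → v 1 ≤ b + M →
        j - M ≤ w 0 → w 0 ≤ j + N + M → b - 1 ≤ w 1 → w 1 ≤ b + M →
        (zdGraph 2).Adj v w → (discreteDomainGraph E.Ω E.δ).Adj v w) →
      4 * R + H + 2 * E.δ ≤ M * E.δ →
      c ∈ meshDomain E.Ω E.δ → c ∉ E.zdArcA ∪ E.zdArcB →
      (¬ ∃ u u' : Site 2, u' ∈ E.zdArcA ∧ u ∉ E.zdArcA ∪ E.zdArcB ∧ s(u, u') ∈ ω ∧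
          s(u, u') ∈ (discreteDomainGraph E.Ω E.δ).edgeSet ∧
          (ω ∩ (discreteDomainGraph E.Ω E.δ).edgeSet) ∈
            openConnIn (meshDomain E.Ω E.δ \ (E.zdArcA ∪ E.zdArcB)) c u) →
      (∃ y₁ : Site 2, (ω ∩ (discreteDomainGraph E.Ω E.δ).edgeSet) ∈
            openConnIn (meshDomain E.Ω E.δ \ (E.zdArcA ∪ E.zdArcB)) c y₁ ∧
          ∀ v : Site 2, j ≤ v 0 → v 0 ≤ j + N → b ≤ v 1 → ((v 1 - b : ℤ) : ℝ) * E.δ ≤ H →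
            3 * R ≤ dist (meshPoint E.δ y₁) (meshPoint E.δ v)) →
      ∀ z : Site 2, (ω ∩ (discreteDomainGraph E.Ω E.δ).edgeSet) ∈
            openConnIn (meshDomain E.Ω E.δ \ (E.zdArcA ∪ E.zdArcB)) c z →
        j ≤ z 0 → z 0 ≤ j + N → b ≤ z 1 → ((z 1 - b : ℤ) : ℝ) * E.δ ≤ H →
        (∀ y : Site 2, (ω ∩ (discreteDomainGraph E.Ω E.δ).edgeSet) ∈
              openConnIn (meshDomain E.Ω E.δ \ (E.zdArcA ∪ E.zdArcB)) c y →
            j ≤ y 0 → y 0 ≤ j + N → b ≤ y 1 → z 1 ≤ y 1) →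
        ∀ R' : ℝ, E.δ ≤ R' → R' ≤ R → (j : ℝ) * E.δ + 4 * R' ≤ (z 0 : ℝ) * E.δ →
          (z 0 : ℝ) * E.δ + 4 * R' ≤ ((j + N : ℤ) : ℝ) * E.δ →
          (∀ w : Site 2, ω ∈ openConnIn {v : Site 2 | b ≤ v 1 ∧ dist (meshPoint E.δ v) (meshPoint E.δ z) ≤ 4 * R'} z w →
              z 1 ≤ w 1) ∧
          (∀ w : Site 2, ω ∈ openConnIn {v : Site 2 | b ≤ v 1 ∧ dist (meshPoint E.δ v) (meshPoint E.δ z) ≤ 4 * R'} z w →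
              w 1 = b → s(w - Pi.single 1 1, w) ∉ ω) ∧
          (∃ w : Site 2, ω ∈ openConnIn {v : Site 2 | b ≤ v 1 ∧ dist (meshPoint E.δ v) (meshPoint E.δ z) ≤ 4 * R'} z w ∧
              3 * R' ≤ dist (meshPoint E.δ w) (meshPoint E.δ z)) := by
  intro E hE ω b j N M c H R hωE _hH _hR hflat hadjflat hM _hc _hcA hmis hfar z hz hjz hzN hbz hzH
    hlow R' hδR' hR'R hleft hright
  have hδ : 0 < E.δ := hE.delta_pos
  have hzH' : (((z 1 : ℤ) : ℝ) - b) * E.δ ≤ H := by push_cast at hzH; exact hzH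
  -- (a) coordinates of the sites within `4R'` of `z`
  have hcoord : ∀ v : Site 2, dist (meshPoint E.δ v) (meshPoint E.δ z) ≤ 4 * R' →
      j ≤ v 0 ∧ v 0 ≤ j + N ∧ v 1 ≤ b + M - 2 := by
    intro v hv
    have h0 := (abs_re_sub_le_dist E.δ v z).trans hv
    have h1 := (abs_im_sub_le_dist E.δ v z).trans hv
    rw [abs_le] at h0 h1
    refine ⟨?_, ?_, ?_⟩
    · have h : (j : ℝ) * E.δ ≤ ((v 0 : ℤ) : ℝ) * E.δ := by linarith [h0.1]
      exact Int.cast_le.1 (le_of_mul_le_mul_right h hδ)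
    · have h : ((v 0 : ℤ) : ℝ) * E.δ ≤ ((j + N : ℤ) : ℝ) * E.δ := by linarith [h0.2]
      exact Int.cast_le.1 (le_of_mul_le_mul_right h hδ)
    · have h : ((v 1 : ℤ) : ℝ) * E.δ ≤ ((b + M - 2 : ℤ) : ℝ) * E.δ := by
        push_cast
        linarith [h1.2]
      exact Int.cast_le.1 (le_of_mul_le_mul_right h hδ)
  -- sites of the half-disc `W` are non-arc box sites of `Ω_δ`
  have hWS : ∀ v : Site 2, b ≤ v 1 → dist (meshPoint E.δ v) (meshPoint E.δ z) ≤ 4 * R' →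
      v ∈ meshDomain E.Ω E.δ \ (E.zdArcA ∪ E.zdArcB) ∧
        j - M ≤ v 0 ∧ v 0 ≤ j + N + M ∧ b - 1 ≤ v 1 ∧ v 1 ≤ b + M := by
    intro v hbv hv
    obtain ⟨hv1, hv2, hv3⟩ := hcoord v hv
    have hb1 : j - M ≤ v 0 := by omega
    have hb2 : v 0 ≤ j + N + M := by omega
    have hb3 : b - 1 ≤ v 1 := by omega
    have hb4 : v 1 ≤ b + M := by omega
    obtain ⟨hvD, hvAiff, hvB⟩ := hflat v hb1 hb2 hb3 hb4
    have hvA : v ∉ E.zdArcA := fun h => by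
      have := hvAiff.1 h
      omega
    exact ⟨⟨hvD, fun h => h.elim hvA hvB⟩, hb1, hb2, hb3, hb4⟩
  -- a raw-`ω` connection inside `W` from `z` is an `ω°`-connection inside `Ω_δ ∖ arcs` from `c`
  have htrans : ∀ w : Site 2,
      ω ∈ openConnIn {v : Site 2 | b ≤ v 1 ∧ dist (meshPoint E.δ v) (meshPoint E.δ z) ≤ 4 * R'} z w →
        (ω ∩ (discreteDomainGraph E.Ω E.δ).edgeSet) ∈
          openConnIn (meshDomain E.Ω E.δ \ (E.zdArcA ∪ E.zdArcB)) c w := by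
    intro w hw
    obtain ⟨p, hpW, hpω⟩ := exists_walk_of_mem_openConnIn hωE hw
    refine PlanarDuality.openConnIn_trans hz
      (mem_openConnIn_of_walk p (fun x hx => (hWS x (hpW x hx).1 (hpW x hx).2).1) fun e he => ?_)
    refine ⟨hpω e he, ?_⟩
    obtain ⟨d, hd, rfl⟩ := List.mem_map.1 he
    have hd1 := hpW _ (p.dart_fst_mem_support_of_mem_darts hd)
    have hd2 := hpW _ (p.dart_snd_mem_support_of_mem_darts hd)
    obtain ⟨-, a1, a2, a3, a4⟩ := hWS _ hd1.1 hd1.2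
    obtain ⟨-, b1, b2, b3, b4⟩ := hWS _ hd2.1 hd2.2
    exact (SimpleGraph.mem_edgeSet _).2 (hadjflat _ _ a1 a2 a3 a4 b1 b2 b3 b4 d.adj)
  refine ⟨fun w hw => ?_, fun w hw hwb => ?_, ?_⟩
  · -- (i) `z` is lowest in its raw cluster inside `W`
    obtain ⟨-, ⟨hbw, hwdist⟩, -⟩ := id hw
    obtain ⟨hw1, hw2, -⟩ := hcoord w hwdist
    exact hlow w (htrans w hw) hw1 hw2 hbw
  · -- (ii) the leg of a row-`b` site of the cluster is closed
    intro hleg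
    obtain ⟨-, ⟨hbw, hwdist⟩, -⟩ := id hw
    obtain ⟨⟨-, hwA⟩, w1, w2, w3, w4⟩ := hWS w hbw hwdist
    have hu0 : (w - Pi.single 1 1 : Site 2) 0 = w 0 := by simp
    have hu1 : (w - Pi.single 1 1 : Site 2) 1 = b - 1 := by simp [hwb]
    obtain ⟨-, huAiff, -⟩ := hflat (w - Pi.single 1 1) (by omega) (by omega) (by omega) (by omega)
    have hDadj : (discreteDomainGraph E.Ω E.δ).Adj w (w - Pi.single 1 1) :=
      hadjflat w (w - Pi.single 1 1) w1 w2 w3 w4 (by omega) (by omega) (by omega) (by omega)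
        (adj_sub_single_one w)
    refine hmis ⟨w, w - Pi.single 1 1, huAiff.2 hu1, hwA, ?_, (SimpleGraph.mem_edgeSet _).2 hDadj,
      htrans w hw⟩
    rw [Sym2.eq_swap]
    exact hleg
  · -- (iii) the cluster reaches distance `3R'` from `z`
    obtain ⟨y₁, hy₁, hfar'⟩ := hfar
    have hzy : (ω ∩ (discreteDomainGraph E.Ω E.δ).edgeSet) ∈
        openConnIn (meshDomain E.Ω E.δ \ (E.zdArcA ∪ E.zdArcB)) z y₁ :=
      PlanarDuality.openConnIn_trans (by rw [openConnIn_comm]; exact hz) hy₁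
    have hω'E : ω ∩ (discreteDomainGraph E.Ω E.δ).edgeSet ⊆ (zdGraph 2).edgeSet :=
      fun e he => hωE he.1
    obtain ⟨p, hpS, hpω'⟩ := exists_walk_of_mem_openConnIn hω'E hzy
    have hPy : 3 * R' ≤ dist (meshPoint E.δ y₁) (meshPoint E.δ z) :=
      le_trans (by linarith) (hfar' z hjz hzN hbz hzH)
    obtain ⟨w, q, hPw, hqsupp, hqedges, hqdarts⟩ :=
      exists_walk_firstHit (fun x : Site 2 => 3 * R' ≤ dist (meshPoint E.δ x) (meshPoint E.δ z))
        p hPy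
    -- every vertex of the prefix is within `4R'` of `z`
    have hqdist : ∀ x ∈ q.support, dist (meshPoint E.δ x) (meshPoint E.δ z) ≤ 4 * R' := by
      intro x hx
      rw [← SimpleGraph.Walk.cons_map_snd_darts, List.mem_cons, List.mem_map] at hx
      rcases hx with rfl | ⟨d, hd, rfl⟩
      · rw [dist_self]
        linarith
      · show dist (meshPoint E.δ d.snd) (meshPoint E.δ z) ≤ 4 * R'
        have h1 : dist (meshPoint E.δ d.fst) (meshPoint E.δ z) < 3 * R' :=
          lt_of_not_ge (hqdarts d hd)
        have h2 : dist (meshPoint E.δ d.snd) (meshPoint E.δ d.fst) ≤ E.δ := by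
          rw [dist_meshPoint_of_adj d.adj.symm, abs_of_pos hδ]
        have h3 := dist_triangle (meshPoint E.δ d.snd) (meshPoint E.δ d.fst) (meshPoint E.δ z)
        linarith
    have hqS : ∀ x ∈ q.support, x ∈ meshDomain E.Ω E.δ \ (E.zdArcA ∪ E.zdArcB) :=
      fun x hx => hpS x (hqsupp x hx)
    -- rows stay `≥ b` along the prefix
    have hqrow : ∀ x ∈ q.support, b ≤ x 1 :=
      walk_rows_ge (A := E.zdArcA) (B := fun v : Site 2 => j - M ≤ v 0 ∧ v 0 ≤ j + N + M) (b := b)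
        (fun v hB heq => (hflat v hB.1 hB.2 (by omega) (by omega)).2.1.2 heq) q
        (fun v hv => by
          obtain ⟨hv1, hv2, -⟩ := hcoord v (hqdist v hv)
          exact ⟨⟨by omega, by omega⟩, fun h => (hqS v hv).2 (Or.inl h)⟩) hbz
    exact ⟨w, mem_openConnIn_of_walk q (fun x hx => ⟨hqrow x hx, hqdist x hx⟩)
      (fun e he => (hpω' e (hqedges e he)).1), hPw⟩

end Summit.CriticalPhenomena.CardyFormulaZ2.Cruxes.LagHandOff.HittingTournament

end
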